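import Summits.RiemannHypothesis.RiemannHypothesis.Theorems.JensenPolynomialsCircleRealPart
import HarnessLib

/-!
# Route `JensenPolynomials`, crux `XiWindowZeroFreeRelFar`, stub `stub_elementary` (far-Gumbel line, S4) — certified
disc inequalities I: the checker and the `ε = 0` profile `Re[Log(1+z) − z + z²/2 − z³/3] ≤ 47/10000` on `‖z‖ ≤ 0.3502`
(RH-FREE; cell rh-jensen, HUMAN RULING D-0040 / D-0074)

LINE 1 (D-0074 framing): elementary complex analysis with a kernel-checked interval certificate; nothing here bears on the
zeros of `ζ` or is progress toward RH.

The far-Gumbel normal form of the crux (theory g8, `Cruxes/XiWindowZeroFreeRelFar`, stub `stub_elementary` v3) reduces the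
B1-rel budget to explicit inequalities for `Log` on the disc `‖z̃‖ ≤ 3502/10000`; the `ε = 0` PROFILE constant is
`c₀ = sup_{‖z‖ ≤ 0.3502} Re[Log(1+z) − (z − z²/2 + z³/3)] = 0.0046344…` (attained at `‖z‖ = 0.3502`, `arg z ≈ ±139.2°`).
We PROVE `c₀ ≤ 47/10000`:

* §1 a generic CHECKER `circUpperCheck ρ cs R B cells` / `circLowerCheck` (cells covering `[−R, R]`, PhiCellArith's exact
  Taylor-shift range `prangeAt` of the circle polynomial `circList ρ 0 cs`) with soundness
  `re_polyC_le_of_circUpperCheck` : on `‖z‖ = R`, `Re(polyC cs z) ≤ B` (and the `≥` version);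
* §2 the instance: `logProfileCoeffs = [0,0,0,0,−1/4,1/5,…,−1/16]` (`polyC … z = logTaylor 17 z − (z − z²/2 + z³/3)`),
  19 cells, `decide` ⇒ `Re ≤ 47/10000 − 10⁻⁸` on the circle; Mathlib's `Complex.norm_log_sub_logTaylor_le`
  (`‖Log(1+z) − logTaylor 17 z‖ ≤ ‖z‖¹⁷/(17(1 − ‖z‖)) < 10⁻⁸`) and the maximum principle for `Re`
  (`re_le_of_forall_mem_sphere`, file `JensenPolynomialsCircleRealPart`) give the disc statement `re_log_sub_cubic_le`.

WHAT THIS IS NOT: nothing about `ξ` or `ζ`. References: Mason–Handscomb, *Chebyshev Polynomials* (2003) §1.2 [MasonHandscomb2003];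
R. E. Moore, *Methods and Applications of Interval Analysis* (1979), Ch. 3 [Moore1979]; Titchmarsh, *Theory of Functions* §5.1 [Titchmarsh1939].
-/

noncomputable section

open Complex Set Metric

-- D-0017: `Summit.RiemannHypothesis.RiemannHypothesis.…` duplicates the namespace BY DESIGN (single-problem summit).
set_option linter.dupNamespace false

namespace Summit.RiemannHypothesis.RiemannHypothesis.Theorems.JensenPolynomials.CoeffTable

/-! ## 1. The checker: `Re P(z) ≤ B` (resp. `≥ B`) on the circle `‖z‖ = R` from finitely many cells -/

/-- Upper-bound checker: the cells cover `[−R, R]` and on each cell the exact Taylor-shift range of the circle polynomial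
`∑ c_k t_k(x)` (`ρ = R²`) has upper end `≤ B`. -/
def circUpperCheck (ρ : ℚ) (cs : List ℚ) (R B : ℚ) (cells : List (ℚ × ℚ)) : Bool :=
  covers cells (-R) R && cells.all fun c => decide ((prangeAt (circList ρ 0 cs) c.1 c.2).2 ≤ B)

/-- Lower-bound checker (lower end of the range `≥ B`). -/
def circLowerCheck (ρ : ℚ) (cs : List ℚ) (R B : ℚ) (cells : List (ℚ × ℚ)) : Bool :=
  covers cells (-R) R && cells.all fun c => decide (B ≤ (prangeAt (circList ρ 0 cs) c.1 c.2).1)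

/-- Soundness of the upper-bound checker on `[−R, R]`. -/
theorem pevalR_circList_le_of_check {ρ : ℚ} {cs : List ℚ} {R B : ℚ} {cells : List (ℚ × ℚ)}
    (h : circUpperCheck ρ cs R B cells = true) {x : ℝ} (h1 : -(R : ℝ) ≤ x) (h2 : x ≤ (R : ℝ)) :
    pevalR (circList ρ 0 cs) x ≤ (B : ℝ) := by
  unfold circUpperCheck at h
  simp only [Bool.and_eq_true, List.all_eq_true, decide_eq_true_eq] at h
  obtain ⟨hcov, hall⟩ := h
  obtain ⟨c, hc, hc1, hc2⟩ := mem_cell_of_covers hcov (y := x) (by push_cast; exact h1) h2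
  have hm := mem_prangeAt (circList ρ 0 cs) hc1 hc2
  exact hm.2.trans (by exact_mod_cast hall c hc)

/-- Soundness of the lower-bound checker on `[−R, R]`. -/
theorem le_pevalR_circList_of_check {ρ : ℚ} {cs : List ℚ} {R B : ℚ} {cells : List (ℚ × ℚ)}
    (h : circLowerCheck ρ cs R B cells = true) {x : ℝ} (h1 : -(R : ℝ) ≤ x) (h2 : x ≤ (R : ℝ)) :
    (B : ℝ) ≤ pevalR (circList ρ 0 cs) x := by
  unfold circLowerCheck at h
  simp only [Bool.and_eq_true, List.all_eq_true, decide_eq_true_eq] at h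
  obtain ⟨hcov, hall⟩ := h
  obtain ⟨c, hc, hc1, hc2⟩ := mem_cell_of_covers hcov (y := x) (by push_cast; exact h1) h2
  have hm := mem_prangeAt (circList ρ 0 cs) hc1 hc2
  exact le_trans (by exact_mod_cast hall c hc) hm.1

/-- **On the circle**: if the upper checker passes with `ρ = R²` then `Re(polyC cs z) ≤ B` for every `‖z‖ = R`. -/
theorem re_polyC_le_of_circUpperCheck {cs : List ℚ} {R B : ℚ} {cells : List (ℚ × ℚ)}
    (h : circUpperCheck (R * R) cs R B cells = true) {z : ℂ} (hz : ‖z‖ = (R : ℝ)) :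
    (polyC cs z).re ≤ (B : ℝ) := by
  have hρ : Complex.normSq z = ((R * R : ℚ) : ℝ) := by
    rw [Complex.normSq_eq_norm_sq, hz]; push_cast; ring
  rw [re_polyC_eq_pevalR_circList hρ]
  have hre : |z.re| ≤ (R : ℝ) := (Complex.abs_re_le_norm z).trans hz.le
  exact pevalR_circList_le_of_check h (abs_le.1 hre).1 (abs_le.1 hre).2

/-- **On the circle**, lower version: `B ≤ Re(polyC cs z)` for every `‖z‖ = R`. -/
theorem le_re_polyC_of_circLowerCheck {cs : List ℚ} {R B : ℚ} {cells : List (ℚ × ℚ)}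
    (h : circLowerCheck (R * R) cs R B cells = true) {z : ℂ} (hz : ‖z‖ = (R : ℝ)) :
    (B : ℝ) ≤ (polyC cs z).re := by
  have hρ : Complex.normSq z = ((R * R : ℚ) : ℝ) := by
    rw [Complex.normSq_eq_norm_sq, hz]; push_cast; ring
  rw [re_polyC_eq_pevalR_circList hρ]
  have hre : |z.re| ≤ (R : ℝ) := (Complex.abs_re_le_norm z).trans hz.le
  exact le_pevalR_circList_of_check h (abs_le.1 hre).1 (abs_le.1 hre).2

/-! ## 2. The `ε = 0` profile: `Re[Log(1+z) − (z − z²/2 + z³/3)] ≤ 47/10000` on `‖z‖ ≤ 3502/10000` -/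

/-- The coefficients of `logTaylor 17 z − (z − z²/2 + z³/3) = ∑_{k=4}^{16} (−1)^{k+1}z^k/k`. -/
def logProfileCoeffs : List ℚ :=
  [0, 0, 0, 0, -1/4, 1/5, -1/6, 1/7, -1/8, 1/9, -1/10, 1/11, -1/12, 1/13, -1/14, 1/15, -1/16]

/-- `polyC logProfileCoeffs z = logTaylor 17 z − (z − z²/2 + z³/3)`. -/
theorem polyC_logProfileCoeffs (z : ℂ) :
    polyC logProfileCoeffs z = Complex.logTaylor 17 z - (z - z ^ 2 / 2 + z ^ 3 / 3) := by
  simp only [polyC, logProfileCoeffs, Complex.logTaylor, Finset.sum_range_succ, Finset.sum_range_zero]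
  push_cast
  ring

/-- The 19 cells `[a, a + h]` covering `[−R, R]`, `R = 3502/10000` (adaptive bisection, generated; checked by `decide`). -/
def logProfileCells : List (ℚ × ℚ) :=
  [((-1751/5000 : ℚ), (1751/80000 : ℚ)),
   ((-5253/16000 : ℚ), (1751/80000 : ℚ)),
   ((-12257/40000 : ℚ), (1751/160000 : ℚ)),
   ((-47277/160000 : ℚ), (1751/160000 : ℚ)),
   ((-22763/80000 : ℚ), (1751/320000 : ℚ)),
   ((-89301/320000 : ℚ), (1751/320000 : ℚ)),
   ((-1751/6400 : ℚ), (1751/320000 : ℚ)),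
   ((-85799/320000 : ℚ), (1751/320000 : ℚ)),
   ((-5253/20000 : ℚ), (1751/80000 : ℚ)),
   ((-19261/80000 : ℚ), (1751/80000 : ℚ)),
   ((-1751/8000 : ℚ), (1751/40000 : ℚ)),
   ((-1751/10000 : ℚ), (1751/20000 : ℚ)),
   ((-1751/20000 : ℚ), (1751/20000 : ℚ)),
   ((0 : ℚ), (1751/20000 : ℚ)),
   ((1751/20000 : ℚ), (1751/20000 : ℚ)),
   ((1751/10000 : ℚ), (1751/40000 : ℚ)),
   ((1751/8000 : ℚ), (1751/40000 : ℚ)),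
   ((5253/20000 : ℚ), (1751/20000 : ℚ)),
   ((1751/5000 : ℚ), (1/1000000 : ℚ))]

/-- The certificate for the circle `‖z‖ = 3502/10000` passes (19 cells; bound `47/10000 − 10⁻⁸`). -/
theorem logProfileCheck :
    circUpperCheck ((3502 / 10000 : ℚ) * (3502 / 10000)) logProfileCoeffs (3502 / 10000) (47 / 10000 - 1 / 10 ^ 8)
      logProfileCells = true := by
  decide +kernel

/-- **On the circle** `‖z‖ = 3502/10000`: `Re[Log(1+z) − (z − z²/2 + z³/3)] ≤ 47/10000`
(certificate `≤ 47/10000 − 10⁻⁸` for the degree-16 Taylor polynomial + `‖Log(1+z) − logTaylor 17 z‖ ≤ R¹⁷/(17(1−R)) < 10⁻⁸`). -/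
theorem re_log_sub_cubic_le_of_norm_eq {z : ℂ} (hz : ‖z‖ = (3502 / 10000 : ℝ)) :
    (Complex.log (1 + z) - (z - z ^ 2 / 2 + z ^ 3 / 3)).re ≤ 47 / 10000 := by
  have hz1 : ‖z‖ < 1 := by rw [hz]; norm_num
  have hpoly : (polyC logProfileCoeffs z).re ≤ ((47 / 10000 - 1 / 10 ^ 8 : ℚ) : ℝ) :=
    re_polyC_le_of_circUpperCheck logProfileCheck (by rw [hz]; norm_num)
  rw [polyC_logProfileCoeffs] at hpoly
  have hrem := Complex.norm_log_sub_logTaylor_le 16 hz1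
  have hsmall : ‖z‖ ^ (16 + 1) * (1 - ‖z‖)⁻¹ / (16 + 1) ≤ 1 / 10 ^ 8 := by
    rw [hz]; norm_num
  have hre : (Complex.log (1 + z) - Complex.logTaylor (16 + 1) z).re ≤ 1 / 10 ^ 8 :=
    (Complex.re_le_norm _).trans (hrem.trans hsmall)
  have e : Complex.log (1 + z) - (z - z ^ 2 / 2 + z ^ 3 / 3) =
      (Complex.log (1 + z) - Complex.logTaylor (16 + 1) z) + (Complex.logTaylor 17 z - (z - z ^ 2 / 2 + z ^ 3 / 3)) := by
    norm_num
  rw [e, Complex.add_re]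
  push_cast at hpoly
  linarith

/-- **The `ε = 0` profile constant of the far-Gumbel line**: for every `‖z‖ ≤ 3502/10000`,
`Re[Log(1+z) − (z − z²/2 + z³/3)] ≤ 47/10000` (true sup `0.0046344`; maximum principle for `Re` from the circle). -/
theorem re_log_sub_cubic_le {z : ℂ} (hz : ‖z‖ ≤ (3502 / 10000 : ℝ)) :
    (Complex.log (1 + z) - (z - z ^ 2 / 2 + z ^ 3 / 3)).re ≤ 47 / 10000 := by
  set R : ℝ := 3502 / 10000 with hR
  have hR0 : 0 < R := by norm_num [hR]
  set f : ℂ → ℂ := fun w => Complex.log (1 + w) - (w - w ^ 2 / 2 + w ^ 3 / 3) with hf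
  have hdiff : DifferentiableOn ℂ f (closure (ball (0 : ℂ) R)) := by
    rw [closure_ball (0 : ℂ) hR0.ne']
    intro w hw
    have hw1 : ‖w‖ < 1 := lt_of_le_of_lt (mem_closedBall_zero_iff.1 hw) (by norm_num [hR])
    have hslit : 1 + w ∈ Complex.slitPlane := Complex.mem_slitPlane_of_norm_lt_one hw1
    have h1 : DifferentiableAt ℂ (fun w : ℂ => Complex.log (1 + w)) w :=
      (Complex.differentiableAt_log hslit).comp w ((differentiableAt_const _).add differentiableAt_id)
    have h2 : DifferentiableAt ℂ (fun w : ℂ => w - w ^ 2 / 2 + w ^ 3 / 3) w := by fun_prop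
    exact (h1.sub h2).differentiableWithinAt
  have hdc : DiffContOnCl ℂ f (ball (0 : ℂ) R) := hdiff.diffContOnCl
  have hsph : ∀ w ∈ sphere (0 : ℂ) R, (f w).re ≤ 47 / 10000 := by
    intro w hw
    rw [mem_sphere_zero_iff_norm] at hw
    exact re_log_sub_cubic_le_of_norm_eq hw
  exact re_le_of_forall_mem_sphere hR0 hdc hsph (mem_closedBall_zero_iff.2 hz)

end Summit.RiemannHypothesis.RiemannHypothesis.Theorems.JensenPolynomials.CoeffTable

end
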